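import Summits.HodgeConjecture.HodgeConjecture.Theorems.R90S6TorusFixedSpecialCount      -- ★ W8-i′ FILE 1 `natCard_fixedBy_special_add_eq_one_add_sum` (a₁ + a₀ = 1 + Σ_x s(x))
import Summits.HodgeConjecture.HodgeConjecture.Theorems.R90S6ResidualStarFixedPoints    -- ★ W8-i″ FILE 2 `natCard_fixedBy_star_eq_ncard_fixed_neighborSet_root`
import Summits.HodgeConjecture.HodgeConjecture.Theorems.R90S6ResidualUnitaryReduction  -- ★ p07 dictionary `exists_residual_unitary`, `residue_vec_eq_smul_iff`, `residue_B₀_eq`, `exists_residualConjugation`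
import Literature.NumberTheory.Automorphic.UnitaryFixedCosetsStableLattices            -- ★ `unitaryInt_eq_glInt_subgroupOf`
import HarnessLib

/-!
# R90 · S6 — LINE S1 ∕ G1, REGIME R-III IN INTRINSIC LETTERS: `a₁ + a₀ = 1` FOR A RESIDUALLY SEPARATED `γ` (sheet v1.5 target (R1′.III) + the residual twin of ★ 3b)
# (`Theorems/R90S6TorusFixedSpecialCountResiduallySeparated.lean`)

Cell `hodgecm-mathlib`, crux H413 (`stmt-HodgeConjecture-24833`), route of record `HCCMUnconditional`; programme R90-TF, section S6 (base `R90-C14`), seat R90-C14-p05 (g0);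
S6 dealer R90-C14-plan (g2) 02:00:44Z «typ1 (g3)'s G1 sheet v1.5 a4e23b2918a2b8c0 target (R1′.III) :210» + RULING 02:08:51Z «v2 = drop (R1.0), keep (R1′.III) + the
residual twin»; the (R1′.III) statement is BYTES-VERBATIM from the sheet.  Helper lane `--supports stmt-HodgeConjecture-24833 --as helper`; THEOREMS ONLY (no definition, no instance, no notation, no named fact, no `sorry`).

THE MATHEMATICS [Kottwitz1988, §2; Rogawski1990, §3.9; Tits1979, §3.5; Serre1980Trees, I.6 and II.1.1].  (R1.0) of the sheet is ★ p07's
`R90S6LevelOnePredicateSectionInvariance` (dealer RULING 02:08:51Z: dropped here, cited by name).  §1 (the RESIDUAL twin of ★ 3b): if `k ∈ K₀` has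
`χ_k ≡ ∏ₗ (X − αₗ)` coefficientwise mod `𝔪` with NORM-ONE `αₗ` (`αₗσ(αₗ) = 1`) and pairwise separated residues, then `k` fixes NO vertex of the star of `L₀`: a fixed star vertex
`κ·N₁` gives a residual isotropic eigenvector `v̄ ≠ 0` of `k̄ ∈ U₃(𝓀)` (★ p07's [3u] skeleton: `mapGL_mul_N₁_eq_iff`, `exists_residual_unitary`, `residue_vec_eq_smul_iff`,
`residue_B₀_eq`); `χ_{k̄} = ∏ₗ (X − ᾱₗ)` has three distinct norm-one roots, `v̄`'s eigenvalue is some `ᾱ_{l₀}`, the eigenvectors `v_j` of the other two roots satisfy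
`B̄₀(v̄, v_j) = 0` (unitarity: `(σᾱ_{l₀}·ᾱ_j − 1)·B̄₀(v̄,v_j) = 0` and `σᾱ_{l₀}·ᾱ_j = 1 ⇒ ᾱ_j = ᾱ_{l₀}` by norm one), and `(v̄, v_{j₁}, v_{j₂})` is a basis
(`Module.End.eigenvectors_linearIndependent'`), so the isotropy `B̄₀(v̄,v̄) = 0` makes `v̄ ⊥ 𝓀³`, `v̄ = 0` — contradiction.  §2 (R1′.III): with ★ FILE 1 `a₁ + a₀ = 1 + Σₓ s(x)` and
`s(x) = 0` at every fixed hyperspecial `x` (§2 at `k_x`, `χ_{k_x} = χ_γ`): **`a₁ + a₀ = 1`**.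
HONEST LABEL: compositions over ★ organs; (R1′.III) is S1's regime R-III in intrinsic letters, count-neutral until the E1.3.5.2 assembly consumes it; proves no printed statement.
HC_CM is proved only modulo the 7 printed citations (2 remaining named inputs: hLiu418 = stmt-HodgeConjecture-24832, h413 = stmt-HodgeConjecture-24833) until rung 0 closes.
-/

set_option autoImplicit false
-- the mandated namespace repeats the single-problem summit's segment (`HodgeConjecture.HodgeConjecture`)
set_option linter.dupNamespace false

noncomputable section

open MulAction Polynomial Module
open Literature.NumberTheory.Automorphic Literature.NumberTheory.Automorphic.HermitianLattice Literature.NumberTheory.Automorphic.UnitaryGroup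
open Literature.NumberTheory.Automorphic.UnitaryLatticeTree
open scoped Matrix MatrixGroups WithZero Valued

namespace Summit.HodgeConjecture.HodgeConjecture.R90.S6

/-! ## §1 The residual twin of ★ 3b: a residually separated norm-one `k ∈ K₀` fixes no vertex of the star -/

/-- **A `k ∈ K₀` with `χ_k ≡ ∏ₗ (X − αₗ) (mod 𝔪)`, `αₗσ(αₗ) = 1`, `|αₗ − αₘ| = 1` (`l ≠ m`) FIXES NO VERTEX OF THE STAR OF THE ROOT** — the residual twin of ★ 3b
`ncard_fixed_neighborSet_root_eq_zero_of_residually_regular`: the reduction `k̄ ∈ U₃(𝓀)` is regular semisimple with norm-one eigenvalues, its eigenlines are pairwise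
orthogonal hence anisotropic, so no isotropic residual line is `k̄`-stable. [cite: Rogawski1990, §3.9 p. 32] [cite: Tits1979, §3.5] -/
theorem ncard_fixed_neighborSet_root_eq_zero_of_charpoly_separated {K : Type*} [Field K] [Valued K ℤᵐ⁰]
    {σ : K →+* K} {ϖ : K} (hd : UnramifiedLocalConjDatum σ ϖ)
    (k : ↥(unitaryGroupOfForm σ ((StdForm.antidiagonal 3).over K))) (hk : k ∈ unitaryInt σ ((StdForm.antidiagonal 3).over K))
    (α : Fin 3 → K) (hαn : ∀ l, α l * σ (α l) = 1) (hsep : ∀ l m, l ≠ m → Valued.v (α l - α m) = 1)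
    (hχ : ∀ i, Valued.v ((((k : GL (Fin 3) K) : Matrix (Fin 3) (Fin 3) K).charpoly - ∏ l : Fin 3, (X - C (α l))).coeff i) < 1) :
    {w : {M : Submodule 𝒪[K] (Fin 3 → K) // IsVertex σ ϖ ((StdForm.antidiagonal 3).over K) M} |
        w ∈ (latticeGraph σ ϖ ((StdForm.antidiagonal 3).over K)).neighborSet ⟨stdLattice K 3, 0, isSelfDualLattice_stdLattice_three hd⟩ ∧
          latticeGraphIso σ ϖ ((StdForm.antidiagonal 3).over K) k w = w}.ncard = 0 := by
  classical
  obtain ⟨hσO, σk, hσk, hσkk⟩ := exists_residualConjugation (K := K) hd.vσ hd.σσ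
  obtain ⟨kb, hkb, hkbe, -⟩ := exists_residual_unitary hσO σk hσk hk
  have hkint := (mem_unitaryInt_iff.1 hk).1
  set kM : Matrix (Fin 3) (Fin 3) K := ((k : GL (Fin 3) K) : Matrix (Fin 3) (Fin 3) K) with hkM
  set kO : Matrix (Fin 3) (Fin 3) 𝒪[K] := Matrix.of fun i j => (⟨kM i j, hkint i j⟩ : 𝒪[K]) with hkO
  have hkOK : kO.map 𝒪[K].subtype = kM := by ext i j; rfl
  have hkbO : (kb : Matrix (Fin 3) (Fin 3) 𝓀[K]) = kO.map (IsLocalRing.residue 𝒪[K]) := by ext i j; rw [hkbe]; rfl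
  have hBb : ∀ u v, B₀ σk 3 ((kb : Matrix (Fin 3) (Fin 3) 𝓀[K]) *ᵥ u) ((kb : Matrix (Fin 3) (Fin 3) 𝓀[K]) *ᵥ v) = B₀ σk 3 u v :=
    (mem_unitaryGroupOfForm_antidiagonal_iff kb).1 hkb
  have hBsl : ∀ (c : 𝓀[K]) (x y : Fin 3 → 𝓀[K]), B₀ σk 3 (c • x) y = σk c * B₀ σk 3 x y := fun c x y => by
    rw [LinearMap.map_smulₛₗ, LinearMap.smul_apply, smul_eq_mul]
  have hBsr : ∀ (c : 𝓀[K]) (x y : Fin 3 → 𝓀[K]), B₀ σk 3 x (c • y) = c * B₀ σk 3 x y := fun c x y => by rw [map_smul, smul_eq_mul]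
  -- the eigenvalue letters: `|αₗ| = 1`, residues `ᾱₗ` distinct of norm one
  have hα1 : ∀ l, Valued.v (α l) = 1 := by
    intro l
    have h : Valued.v (α l) * Valued.v (α l) = 1 := by
      have h' := congrArg Valued.v (hαn l)
      rwa [map_mul, hd.vσ, map_one] at h'
    rcases le_total (Valued.v (α l)) 1 with hle | hge
    · by_contra hne
      exact absurd h (mul_lt_one_of_lt_of_le (lt_of_le_of_ne hle hne) hle).ne
    · by_contra hne
      exact absurd h (one_lt_mul_of_lt_of_le' (lt_of_le_of_ne hge (Ne.symm hne)) hge).ne'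
  set αO : Fin 3 → 𝒪[K] := fun l => ⟨α l, (hα1 l).le⟩ with hαO
  have hαbsep : Function.Injective fun l => IsLocalRing.residue 𝒪[K] (αO l) := by
    intro l m hlm
    by_contra hne
    have h : IsLocalRing.residue 𝒪[K] (αO l - αO m) = 0 := by rw [map_sub, sub_eq_zero]; exact hlm
    rw [residue_eq_zero_iff_v_lt_one, coe_sub_eq] at h
    exact absurd (hsep l m hne) h.ne
  have hαbn : ∀ l, σk (IsLocalRing.residue 𝒪[K] (αO l)) * IsLocalRing.residue 𝒪[K] (αO l) = 1 := by
    intro l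
    have h1 : (⟨σ (αO l : K), hσO (αO l)⟩ * αO l : 𝒪[K]) = 1 := Subtype.ext (by push_cast; rw [mul_comm]; exact hαn l)
    rw [← hσk, ← map_mul, h1, map_one]
  -- the residual characteristic polynomial `χ_{k̄} = ∏ (X − ᾱₗ)`
  have hχb : ((kb : GL (Fin 3) 𝓀[K]) : Matrix (Fin 3) (Fin 3) 𝓀[K]).charpoly = ∏ l : Fin 3, (X - C (IsLocalRing.residue 𝒪[K] (αO l))) := by
    have hO : ∀ i, Valued.v (((kO.charpoly - ∏ l : Fin 3, (X - C (αO l))).coeff i : 𝒪[K]) : K) < 1 := by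
      intro i
      have h1 : (kO.charpoly - ∏ l : Fin 3, (X - C (αO l))).map 𝒪[K].subtype = kM.charpoly - ∏ l : Fin 3, (X - C (α l)) := by
        rw [Polynomial.map_sub, ← Matrix.charpoly_map, hkOK, Polynomial.map_prod]
        simp only [Polynomial.map_sub, Polynomial.map_X, Polynomial.map_C]
        rfl
      have h2 := Polynomial.coeff_map 𝒪[K].subtype (p := kO.charpoly - ∏ l : Fin 3, (X - C (αO l))) i
      rw [h1] at h2
      rw [← 𝒪[K].subtype_apply, ← h2]; exact hχ i
    have hz : (kO.charpoly - ∏ l : Fin 3, (X - C (αO l))).map (IsLocalRing.residue 𝒪[K]) = 0 := by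
      ext i
      rw [Polynomial.coeff_map, coeff_zero, residue_eq_zero_iff_v_lt_one]; exact hO i
    rw [hkbO, Matrix.charpoly_map]
    rw [Polynomial.map_sub, sub_eq_zero] at hz
    rw [hz, Polynomial.map_prod]
    simp only [Polynomial.map_sub, Polynomial.map_X, Polynomial.map_C]
  -- non-degeneracy of the residual form
  have hnondeg : ∀ x : Fin 3 → 𝓀[K], (∀ y, B₀ σk 3 x y = 0) → x = 0 := by
    intro x hx
    funext i
    have h := hx (Pi.single (Fin.rev i) 1)
    rw [B₀_apply, Finset.sum_eq_single i (fun b _ hb => by rw [Pi.single_eq_of_ne (fun h => hb (Fin.rev_injective h)), mul_zero])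
      (fun h => absurd (Finset.mem_univ i) h), Pi.single_eq_same, mul_one] at h
    exact (map_eq_zero_iff σk σk.injective).1 h
  -- THE FIXED STAR IS EMPTY: a fixed star vertex would give a residual isotropic eigenvector of `k̄`
  suffices hempty : ∀ w : {M : Submodule 𝒪[K] (Fin 3 → K) // IsVertex σ ϖ ((StdForm.antidiagonal 3).over K) M},
      ¬ (w ∈ (latticeGraph σ ϖ ((StdForm.antidiagonal 3).over K)).neighborSet ⟨stdLattice K 3, 0, isSelfDualLattice_stdLattice_three hd⟩ ∧
        latticeGraphIso σ ϖ ((StdForm.antidiagonal 3).over K) k w = w) by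
    have hS : {w : {M : Submodule 𝒪[K] (Fin 3 → K) // IsVertex σ ϖ ((StdForm.antidiagonal 3).over K) M} |
        w ∈ (latticeGraph σ ϖ ((StdForm.antidiagonal 3).over K)).neighborSet ⟨stdLattice K 3, 0, isSelfDualLattice_stdLattice_three hd⟩ ∧
          latticeGraphIso σ ϖ ((StdForm.antidiagonal 3).over K) k w = w} = ∅ :=
      Set.eq_empty_iff_forall_notMem.2 fun w hw => hempty w hw
    rw [hS, Set.ncard_empty]
  rintro w ⟨hwstar, hkw⟩
  obtain ⟨κ, hκ, hw1⟩ := (mem_neighborSet_root_iff_exists_mem_unitaryInt hd w).1 hwstar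
  rw [latticeGraphIso_apply_eq_self_iff, hw1] at hkw
  obtain ⟨c₁, hc₁, hc₁x⟩ := (mapGL_mul_N₁_eq_iff hd.vσ hd.vϖ hk hκ).1 hkw
  -- the first column `x' = κ e₀` of `κ` in integral letters and its reduction `v̄`
  obtain ⟨κb, -, hκbe, -⟩ := exists_residual_unitary hσO σk hσk hκ
  set X' : Fin 3 → 𝒪[K] := fun i => (⟨((κ : GL (Fin 3) K) : Matrix (Fin 3) (Fin 3) K) i 0, (mem_unitaryInt_iff.1 hκ).1 i 0⟩ : 𝒪[K]) with hX'
  obtain ⟨vb, hvb⟩ : ∃ v : Fin 3 → 𝓀[K], v = fun i => IsLocalRing.residue 𝒪[K] (X' i) := ⟨_, rfl⟩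
  have hx'e : (fun i => (X' i : K)) = ((κ : GL (Fin 3) K) : Matrix (Fin 3) (Fin 3) K) *ᵥ Pi.single 0 1 := by
    funext i
    simp [hX', Matrix.mulVec, dotProduct, Pi.single_apply]
  -- `v̄ ≠ 0` (`κ̄` is invertible)
  have hvb0 : vb ≠ 0 := by
    intro h0
    have h1 : (((κb⁻¹ : GL (Fin 3) 𝓀[K]) : Matrix (Fin 3) (Fin 3) 𝓀[K]) * (κb : Matrix (Fin 3) (Fin 3) 𝓀[K])) 0 0 = 1 := by
      rw [← Units.val_mul, inv_mul_cancel, Units.val_one, Matrix.one_apply_eq]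
    rw [Matrix.mul_apply] at h1
    have hcol : ∀ i, (κb : Matrix (Fin 3) (Fin 3) 𝓀[K]) i 0 = 0 := fun i => by rw [hκbe]; exact (congrFun (hvb ▸ h0) i :)
    simp only [hcol, mul_zero, Finset.sum_const_zero] at h1
    exact zero_ne_one h1
  -- `k̄ v̄ = c̄₁ v̄`
  set c₁O : 𝒪[K] := ⟨c₁, (Valuation.mem_integer_iff _ _).2 hc₁.le⟩ with hc₁O
  have hfix₁ : (kb : Matrix (Fin 3) (Fin 3) 𝓀[K]) *ᵥ vb = IsLocalRing.residue 𝒪[K] c₁O • vb := by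
    rw [hvb, hkbO, ← residue_mulVec_eq]
    refine (residue_vec_eq_smul_iff (kO *ᵥ X') X' c₁O).2 fun i => ?_
    have e : (((kO *ᵥ X') i : 𝒪[K]) : K) =
        (((k : GL (Fin 3) K) : Matrix (Fin 3) (Fin 3) K) * ((κ : GL (Fin 3) K) : Matrix (Fin 3) (Fin 3) K)) i 0 := by
      rw [Matrix.mul_apply]
      simp only [Matrix.mulVec, dotProduct]
      push_cast
      rfl
    rw [e]
    exact hc₁x i
  -- `v̄` is isotropic: `B₀ (κe₀) (κe₀) = B₀ e₀ e₀ = 0`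
  have huκ := (mem_unitaryGroupOfForm_antidiagonal_iff (κ : GL (Fin 3) K)).1 κ.2
  have hvbiso : B₀ σk 3 vb vb = 0 := by
    have h0 : B₀ σ 3 (fun i => (X' i : K)) (fun i => (X' i : K)) = 0 := by
      rw [hx'e, huκ, B₀_single_left]
      simp
    rw [hvb, ← residue_B₀_eq hσO σk hσk X' X', show (⟨_, B₀_coe_mem_integer hσO X' X'⟩ : 𝒪[K]) = 0 from Subtype.ext h0, map_zero]
  -- LINEAR ALGEBRA over `𝓀`: `c̄₁ = ᾱ_{l₀}`, eigenvectors of the other roots, orthogonality, spanning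
  set f : Module.End 𝓀[K] (Fin 3 → 𝓀[K]) := Matrix.toLin' (kb : Matrix (Fin 3) (Fin 3) 𝓀[K]) with hf
  have hfχ : f.charpoly = ∏ l : Fin 3, (X - C (IsLocalRing.residue 𝒪[K] (αO l))) := by rw [hf, Matrix.charpoly_toLin', hχb]
  have hev : f.HasEigenvector (IsLocalRing.residue 𝒪[K] c₁O) vb :=
    ⟨by rw [Module.End.mem_eigenspace_iff, hf, Matrix.toLin'_apply]; exact hfix₁, hvb0⟩
  obtain ⟨l₀, hl₀⟩ : ∃ l₀, IsLocalRing.residue 𝒪[K] c₁O = IsLocalRing.residue 𝒪[K] (αO l₀) := by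
    have hroot := (Module.End.hasEigenvalue_iff_isRoot_charpoly f _).1 (Module.End.hasEigenvalue_of_hasEigenvector hev)
    rw [hfχ, IsRoot, eval_prod, Finset.prod_eq_zero_iff] at hroot
    obtain ⟨l, -, hl⟩ := hroot
    rw [eval_sub, eval_X, eval_C, sub_eq_zero] at hl
    exact ⟨l, hl⟩
  have hevl : ∀ l, f.HasEigenvalue (IsLocalRing.residue 𝒪[K] (αO l)) := fun l => by
    rw [Module.End.hasEigenvalue_iff_isRoot_charpoly, hfχ, IsRoot, eval_prod, Finset.prod_eq_zero_iff]
    exact ⟨l, Finset.mem_univ _, by rw [eval_sub, eval_X, eval_C, sub_self]⟩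
  choose v hv using fun l => (hevl l).exists_hasEigenvector
  obtain ⟨u, hu⟩ : ∃ u : Fin 3 → (Fin 3 → 𝓀[K]), u = fun l => if l = l₀ then vb else v l := ⟨_, rfl⟩
  have hul₀ : u l₀ = vb := by rw [hu]; simp
  have hul : ∀ l, l ≠ l₀ → u l = v l := fun l hl => by rw [hu]; simp [hl]
  have huev : ∀ l, f.HasEigenvector (IsLocalRing.residue 𝒪[K] (αO l)) (u l) := by
    intro l
    by_cases hl : l = l₀
    · rw [hl, hul₀, ← hl₀]; exact hev
    · rw [hul l hl]; exact hv l
  have hind : LinearIndependent 𝓀[K] u := Module.End.eigenvectors_linearIndependent' f _ hαbsep u huev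
  have hspan : Submodule.span 𝓀[K] (Set.range u) = ⊤ :=
    hind.span_eq_top_of_card_eq_finrank' (by rw [Fintype.card_fin, Module.finrank_fin_fun])
  -- orthogonality `B̄₀(v̄, u l) = 0` for every `l`
  have hkbu : ∀ l, (kb : Matrix (Fin 3) (Fin 3) 𝓀[K]) *ᵥ u l = IsLocalRing.residue 𝒪[K] (αO l) • u l := fun l => by
    have h := (huev l).1
    rwa [Module.End.mem_eigenspace_iff, hf, Matrix.toLin'_apply] at h
  have horth : ∀ l, B₀ σk 3 vb (u l) = 0 := by
    intro l
    by_cases hl : l = l₀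
    · rw [hl, hul₀]; exact hvbiso
    · have h := hBb vb (u l)
      rw [hfix₁, hkbu, hl₀, hBsl, hBsr, ← mul_assoc] at h
      have hcoef : σk (IsLocalRing.residue 𝒪[K] (αO l₀)) * IsLocalRing.residue 𝒪[K] (αO l) - 1 ≠ 0 := by
        intro h0
        apply hl
        apply hαbsep
        have h1 := hαbn l₀
        -- `σ ᾱ₀ · ᾱ_l = 1 = σ ᾱ₀ · ᾱ₀` ⇒ `ᾱ_l = ᾱ₀`
        have hσ0 : σk (IsLocalRing.residue 𝒪[K] (αO l₀)) ≠ 0 := fun hz => by rw [hz, zero_mul] at h1; exact zero_ne_one h1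
        exact mul_left_cancel₀ hσ0 (by rw [h1]; exact (sub_eq_zero.1 h0))
      have h' : (σk (IsLocalRing.residue 𝒪[K] (αO l₀)) * IsLocalRing.residue 𝒪[K] (αO l) - 1) * B₀ σk 3 vb (u l) = 0 := by
        rw [sub_mul, one_mul, sub_eq_zero]; exact h
      exact (mul_eq_zero.1 h').resolve_left hcoef
  -- hence `B̄₀(v̄, ·) = 0` and `v̄ = 0`
  refine hvb0 (hnondeg vb fun y => ?_)
  have hy : y ∈ Submodule.span 𝓀[K] (Set.range u) := by rw [hspan]; exact Submodule.mem_top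
  refine Submodule.span_induction (p := fun y _ => B₀ σk 3 vb y = 0) ?_ ?_ ?_ ?_ hy
  · rintro _ ⟨l, rfl⟩; exact horth l
  · exact map_zero _
  · intro a b _ _ ha hb; rw [map_add, ha, hb, add_zero]
  · intro c a _ ha; rw [map_smul, ha, smul_zero]

/-! ## §2 (R1′.III) `a₁ + a₀ = 1` for a residually separated `γ` -/

-- the quotient-action instances `MulAction ↥K₀ (↥K₀ ⧸ I.subgroupOf K₀)` of ★ FILE 1 ∕ FILE 2 exceed the default synthesis budget (same bump as those ★ files)
set_option synthInstance.maxHeartbeats 400000 in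
set_option maxHeartbeats 1600000 in
/-- **(R1′.III) — TYPE (1), ALL RESIDUES SEPARATED: `a₁ + a₀ = 1`.**  In ★ FILE 1's letters: if `χ_γ ≡ ∏ₗ (X − αₗ)` coefficientwise mod `𝔪` with norm-one `αₗ`
(`αₗσ(αₗ) = 1`) and pairwise separated residues, then every local monodromy `k_x` fixes no special neighbour (§1 at `k_x`, `χ_{k_x} = χ_γ`), so ★ FILE 1 reads
`a₁ + a₀ = 1 + 0`. [cite: Kottwitz1988, §2] [cite: Rogawski1990, §3.9 p. 32] -/
theorem natCard_fixedBy_special_add_eq_one_of_residually_separated {K : Type*} [Field K] [Valued K ℤᵐ⁰] [ValuativeRel K] [(Valued.v : Valuation K ℤᵐ⁰).Compatible]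
    {σ : K →+* K} {ϖ : K} (hd : UnramifiedLocalConjDatum σ ϖ)
    (g₁ : GL (Fin 3) K) (hg₁ : (g₁ : Matrix (Fin 3) (Fin 3) K) = Matrix.diagonal ![(1 : K), 1, ϖ])
    (γ : ↥(unitaryGroupOfForm σ ((StdForm.antidiagonal 3).over K)))
    [Fintype (fixedBy (↥(unitaryGroupOfForm σ ((StdForm.antidiagonal 3).over K)) ⧸
      (glInt 3 K).subgroupOf (unitaryGroupOfForm σ ((StdForm.antidiagonal 3).over K))) γ)]
    (hK₁fin : (fixedBy (↥(unitaryGroupOfForm σ ((StdForm.antidiagonal 3).over K)) ⧸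
      ((glInt 3 K).map (MulAut.conj g₁).toMonoidHom).subgroupOf (unitaryGroupOfForm σ ((StdForm.antidiagonal 3).over K))) γ).Finite)
    (horb : (Set.range fun n : ℕ => ((γ ^ n : ↥(unitaryGroupOfForm σ ((StdForm.antidiagonal 3).over K))) :
      ↥(unitaryGroupOfForm σ ((StdForm.antidiagonal 3).over K)) ⧸ (glInt 3 K).subgroupOf (unitaryGroupOfForm σ ((StdForm.antidiagonal 3).over K)))).Finite)
    (r : ↥(unitaryGroupOfForm σ ((StdForm.antidiagonal 3).over K)) ⧸ (glInt 3 K).subgroupOf (unitaryGroupOfForm σ ((StdForm.antidiagonal 3).over K)) →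
      ↥(unitaryGroupOfForm σ ((StdForm.antidiagonal 3).over K)))
    (hr : Function.RightInverse r QuotientGroup.mk)
    [∀ x : fixedBy (↥(unitaryGroupOfForm σ ((StdForm.antidiagonal 3).over K)) ⧸
        (glInt 3 K).subgroupOf (unitaryGroupOfForm σ ((StdForm.antidiagonal 3).over K))) γ,
      Finite (fixedBy (↥((glInt 3 K).subgroupOf (unitaryGroupOfForm σ ((StdForm.antidiagonal 3).over K))) ⧸
        (((glInt 3 K).subgroupOf (unitaryGroupOfForm σ ((StdForm.antidiagonal 3).over K)) ⊓
          ((glInt 3 K).map (MulAut.conj g₁).toMonoidHom).subgroupOf (unitaryGroupOfForm σ ((StdForm.antidiagonal 3).over K))).subgroupOf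
          ((glInt 3 K).subgroupOf (unitaryGroupOfForm σ ((StdForm.antidiagonal 3).over K)))))
        (⟨(r x.1)⁻¹ * γ * r x.1, inv_mul_mul_mem_of_smul_eq r hr γ x.2⟩ :
          ↥((glInt 3 K).subgroupOf (unitaryGroupOfForm σ ((StdForm.antidiagonal 3).over K)))))]
    (α : Fin 3 → K) (hαn : ∀ l, α l * σ (α l) = 1) (hsep : ∀ l m, l ≠ m → Valued.v (α l - α m) = 1)
    (hχ : ∀ i, Valued.v (((((γ : ↥(unitaryGroupOfForm σ ((StdForm.antidiagonal 3).over K))) : GL (Fin 3) K) : Matrix (Fin 3) (Fin 3) K).charpoly -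
      ∏ l : Fin 3, (X - C (α l))).coeff i) < 1) :
    Nat.card (fixedBy (↥(unitaryGroupOfForm σ ((StdForm.antidiagonal 3).over K)) ⧸
        ((glInt 3 K).map (MulAut.conj g₁).toMonoidHom).subgroupOf (unitaryGroupOfForm σ ((StdForm.antidiagonal 3).over K))) γ) +
      Nat.card (fixedBy (↥(unitaryGroupOfForm σ ((StdForm.antidiagonal 3).over K)) ⧸
        (glInt 3 K).subgroupOf (unitaryGroupOfForm σ ((StdForm.antidiagonal 3).over K))) γ) = 1 := by
  classical
  -- ★ FILE 1: `a₁ + a₀ = 1 + Σ_x s(x)`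
  have h1 := natCard_fixedBy_special_add_eq_one_add_sum hd g₁ hg₁ γ hK₁fin horb r hr
  -- every summand vanishes: §1 at `k_x`
  have hsx : ∀ x : fixedBy (↥(unitaryGroupOfForm σ ((StdForm.antidiagonal 3).over K)) ⧸
      (glInt 3 K).subgroupOf (unitaryGroupOfForm σ ((StdForm.antidiagonal 3).over K))) γ,
      Nat.card (fixedBy (↥((glInt 3 K).subgroupOf (unitaryGroupOfForm σ ((StdForm.antidiagonal 3).over K))) ⧸
        (((glInt 3 K).subgroupOf (unitaryGroupOfForm σ ((StdForm.antidiagonal 3).over K)) ⊓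
          ((glInt 3 K).map (MulAut.conj g₁).toMonoidHom).subgroupOf (unitaryGroupOfForm σ ((StdForm.antidiagonal 3).over K))).subgroupOf
          ((glInt 3 K).subgroupOf (unitaryGroupOfForm σ ((StdForm.antidiagonal 3).over K)))))
        (⟨(r x.1)⁻¹ * γ * r x.1, inv_mul_mul_mem_of_smul_eq r hr γ x.2⟩ :
          ↥((glInt 3 K).subgroupOf (unitaryGroupOfForm σ ((StdForm.antidiagonal 3).over K))))) = 0 := by
    intro x
    rw [natCard_fixedBy_star_eq_ncard_fixed_neighborSet_root hd g₁ hg₁ _ (inv_mul_mul_mem_of_smul_eq r hr γ x.2)]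
    have hkK₀ : ((r x.1)⁻¹ * γ * r x.1 : ↥(unitaryGroupOfForm σ ((StdForm.antidiagonal 3).over K))) ∈ unitaryInt σ ((StdForm.antidiagonal 3).over K) := by
      rw [unitaryInt_eq_glInt_subgroupOf]
      exact inv_mul_mul_mem_of_smul_eq r hr γ x.2
    have hχk : ((((r x.1)⁻¹ * γ * r x.1 : ↥(unitaryGroupOfForm σ ((StdForm.antidiagonal 3).over K))) : GL (Fin 3) K) : Matrix (Fin 3) (Fin 3) K).charpoly =
        (((γ : ↥(unitaryGroupOfForm σ ((StdForm.antidiagonal 3).over K))) : GL (Fin 3) K) : Matrix (Fin 3) (Fin 3) K).charpoly := by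
      rw [Subgroup.coe_mul, Subgroup.coe_mul, Subgroup.coe_inv, Units.val_mul, Units.val_mul, Matrix.coe_units_inv]
      exact Matrix.charpoly_units_conj' _ _
    exact ncard_fixed_neighborSet_root_eq_zero_of_charpoly_separated hd _ hkK₀ α hαn hsep fun i => by rw [hχk]; exact hχ i
  rw [Finset.sum_congr rfl fun x _ => hsx x, Finset.sum_const_zero, add_zero] at h1
  exact h1

end Summit.HodgeConjecture.HodgeConjecture.R90.S6

end
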